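import Mathlib
import Summits.QuantumFields.QCD.Theorems.QuarksAsStableActionUnquenchedChessboardBoundStubMarginalRPChiral
import Literature.MathematicalPhysics.QuantumFieldTheory.WilsonSiteRPForm
import HarnessLib

/-!
# Chirality blocks of the Wilson–Dirac matrix at the site-reflection planes (stub
`stub_marginalRP` of crux stmt-QuantumFields-9735, line Sketch — helper file 3)

For the `r = 1` Wilson–Dirac matrix `D' = wilsonDiracG ρ chiralGamma V m 1` on the even
four-torus (side `L ≥ 4`, planes `t = 0` and `t = L/2`, time = direction `0`) we record the
entry-level facts behind the chirality-split block decomposition: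

* time arithmetic of shifts and of the site reflection `siteTimeNeg` (`tv`, `tv_shift_zero`, …);
* the spin tables of `1 ∓ γ'₀` (chirality projections) and of `1 ∓ γ'_k` on chirality-compatible
  indices, and the resulting vanishing / same-slice form of the entries of `D'`
  (`wdc_eq_zero`, `wdc_eq_zero_of_tv`, `wdc_sameSlice`, with the chirality-diagonal spatial plane
  operator `planeOp`);
* the UPPER indices `upIdx` (interior `0 < t < L/2` with all spins; plane `t = 0` with the lower
  spinor components; plane `t = L/2` with the upper ones), the plane indices `planeIdx`, the plane
  chirality flip `piMap` and the site reflection `sigmaMap` on indices;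
* the two cross blocks coincide and live on the planes:
  `D'(p, σ q) = D'(σ π p, π q) = [p, q plane] D'(p, q)` for upper `p, q`
  (`crossBlock₁_entry`, `crossBlock₂_entry`).
-/

noncomputable section

open Matrix Complex Finset
open Literature.MathematicalPhysics.QuantumLattice Literature.MathematicalPhysics.QuantumFieldTheory
open Literature.Probability.LatticeModels
open scoped ComplexConjugate BigOperators

namespace Summit.QuantumFields.QCD.Theorems.UnquenchedChessboardBoundLine

/-! ## Time arithmetic on the four-torus -/

section SiteArith

variable {L : ℕ} [NeZero L]

/-- The time coordinate of a site, as a natural number in `[0, L)`. -/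
def tv (x : TorusSite 4 L) : ℕ := (x 0).val

/-- `tv x < L`. -/
theorem tv_lt (x : TorusSite 4 L) : tv x < L := ZMod.val_lt _

omit [NeZero L] in
/-- Spatial shifts do not change the time. -/
theorem tv_shift_ne (x : TorusSite 4 L) {k : Fin 4} (hk : k ≠ 0) : tv (Site.shift x k) = tv x :=
  WilsonRP.val_shift_of_ne x (Ne.symm hk)

/-- Time of the reflected site. -/
theorem tv_siteTimeNeg (x : TorusSite 4 L) : tv (siteTimeNeg x) = if tv x = 0 then 0 else L - tv x :=
  WilsonSiteRP.val_negReflect x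

/-- The reflection fixes the sites of the two planes. -/
theorem siteTimeNeg_of_plane (hL : Even L) {x : TorusSite 4 L} (h : tv x = 0 ∨ tv x = L / 2) :
    siteTimeNeg x = x :=
  WilsonSiteRP.negReflect_of_two_mul (WilsonRP.two_mul_eq_zero_of_val hL h)

variable [Fact (1 < L)]

/-- Time of `x + ê₀`. -/
theorem tv_shift_zero (x : TorusSite 4 L) :
    tv (Site.shift x 0) = if tv x + 1 = L then 0 else tv x + 1 :=
  WilsonRP.val_shift_self x 0

omit [NeZero L] in
/-- `x + ê_μ ≠ x`. -/
theorem shift_ne_self (x : TorusSite 4 L) (μ : Fin 4) : Site.shift x μ ≠ x := by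
  intro h
  have h1 := congrFun h μ
  rw [WilsonRP.shift_apply_self, add_eq_left] at h1
  exact one_ne_zero h1

omit [NeZero L] in
/-- `x + ê_μ = x + ê_ν ↔ μ = ν`. -/
theorem shift_eq_shift_iff (x : TorusSite 4 L) {μ ν : Fin 4} : Site.shift x μ = Site.shift x ν ↔ μ = ν := by
  refine ⟨fun h => ?_, fun h => by rw [h]⟩
  by_contra hne
  have h1 := congrFun h μ
  rw [WilsonRP.shift_apply_self, WilsonRP.shift_apply_of_ne _ hne, add_eq_left] at h1
  exact one_ne_zero h1

end SiteArith

/-! ## Spin tables: chirality projections and spatial matrices -/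

/-- `(1 - γ'₀)_{αβ} = 2 [α = β lower]`. -/
theorem projMinus_gamma0_apply (α β : Fin 4) :
    ((1 : Matrix (Fin 4) (Fin 4) ℂ) - chiralGamma 0) α β = if α = β ∧ 2 ≤ α.val then 2 else 0 := by
  fin_cases α <;> fin_cases β <;> simp [chiralGamma] <;> norm_num

/-- `(1 + γ'₀)_{αβ} = 2 [α = β upper]`. -/
theorem projPlus_gamma0_apply (α β : Fin 4) :
    ((1 : Matrix (Fin 4) (Fin 4) ℂ) + chiralGamma 0) α β = if α = β ∧ α.val < 2 then 2 else 0 := by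
  fin_cases α <;> fin_cases β <;> simp [chiralGamma] <;> norm_num

/-- On chirality-compatible indices the spatial `1 - γ'_k` is the identity. -/
theorem projMinus_spatial_apply (k α β : Fin 4) (hk : k ≠ 0) (h : α.val < 2 ↔ β.val < 2) :
    ((1 : Matrix (Fin 4) (Fin 4) ℂ) - chiralGamma k) α β = if α = β then 1 else 0 := by
  fin_cases k <;> fin_cases α <;> fin_cases β <;> simp_all [chiralGamma]

/-- On chirality-compatible indices the spatial `1 + γ'_k` is the identity. -/
theorem projPlus_spatial_apply (k α β : Fin 4) (hk : k ≠ 0) (h : α.val < 2 ↔ β.val < 2) :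
    ((1 : Matrix (Fin 4) (Fin 4) ℂ) + chiralGamma k) α β = if α = β then 1 else 0 := by
  fin_cases k <;> fin_cases α <;> fin_cases β <;> simp_all [chiralGamma]

/-- The values of the chirality flip. -/
theorem sflip_val (α : Fin 4) : (sflip α).val = if α.val < 2 then α.val + 2 else α.val - 2 := by
  fin_cases α <;> rfl

/-! ## Entries of the chiral Wilson–Dirac matrix -/

section Entries

variable {L N : ℕ} [NeZero L] {G : Type*} [Group G] (ρ : G →* Matrix (Fin N) (Fin N) ℂ)

/-- The chirality-diagonal spatial Wilson operator of a time slice, `(m + 4) - ½ Σ_k (V_k τ_k + h.c.)`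
on site × colour. -/
def planeOp (V : GaugeConfig 4 L G) (m : ℝ) (x : TorusSite 4 L) (a : Fin N) (y : TorusSite 4 L)
    (b : Fin N) : ℂ :=
  (if x = y ∧ a = b then ((m + 4 : ℝ) : ℂ) else 0) -
    (1 / 2 : ℂ) * ∑ k : Fin 4, if k = 0 then 0 else
      ((if y = Site.shift x k then ρ (V (x, k)) a b else 0) +
        (if x = Site.shift y k then ρ (V (y, k))⁻¹ a b else 0))

omit [NeZero L] in
/-- General vanishing of an entry: no diagonal, no spatial adjacency, and time hops killed by the
chirality projections. -/
theorem wdc_eq_zero (V : GaugeConfig 4 L G) (m : ℝ) {p q : TorusSite 4 L × Fin N × Fin 4} (hd : p ≠ q)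
    (hf0 : q.1 = Site.shift p.1 0 → p.2.2.val < 2 ∨ q.2.2.val < 2)
    (hb0 : p.1 = Site.shift q.1 0 → 2 ≤ p.2.2.val ∨ 2 ≤ q.2.2.val)
    (hfk : ∀ k : Fin 4, k ≠ 0 → q.1 ≠ Site.shift p.1 k)
    (hbk : ∀ k : Fin 4, k ≠ 0 → p.1 ≠ Site.shift q.1 k) :
    wilsonDiracG ρ chiralGamma V m 1 p q = 0 := by
  simp only [wilsonDiracG, Matrix.of_apply, if_neg hd, zero_sub, neg_eq_zero, mul_eq_zero,
    Complex.ofReal_one, one_smul]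
  refine Or.inr (Finset.sum_eq_zero fun μ _ => ?_)
  by_cases hμ : μ = 0
  · subst hμ
    refine add_eq_zero_iff_eq_neg.2 ?_
    rw [show (if p.1 = Site.shift q.1 0 then
        ((1 : Matrix (Fin 4) (Fin 4) ℂ) + chiralGamma 0) p.2.2 q.2.2 * ρ (V (q.1, 0))⁻¹ p.2.1 q.2.1 else 0) = 0 by
      split_ifs with h
      · rw [projPlus_gamma0_apply, if_neg, zero_mul]
        rintro ⟨he, h2⟩
        rcases hb0 h with h' | h'
        · omega
        · rw [he] at h2; omega
      · rfl, neg_zero]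
    split_ifs with h
    · rw [projMinus_gamma0_apply, if_neg, zero_mul]
      rintro ⟨he, h2⟩
      rcases hf0 h with h' | h'
      · omega
      · rw [he] at h2; omega
    · rfl
  · rw [if_neg (hfk μ hμ), if_neg (hbk μ hμ), add_zero]

variable [Fact (1 < L)]

omit [NeZero L] [Fact (1 < L)] in
/-- `tv` distinguishes sites. -/
theorem ne_of_tv_ne {x y : TorusSite 4 L} (h : tv x ≠ tv y) : x ≠ y := fun e => h (by rw [e])

/-- Vanishing of an entry from time arithmetic. -/
theorem wdc_eq_zero_of_tv (V : GaugeConfig 4 L G) (m : ℝ) {p q : TorusSite 4 L × Fin N × Fin 4}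
    (ht : tv p.1 ≠ tv q.1)
    (hf0 : tv q.1 = (if tv p.1 + 1 = L then 0 else tv p.1 + 1) → p.2.2.val < 2 ∨ q.2.2.val < 2)
    (hb0 : tv p.1 = (if tv q.1 + 1 = L then 0 else tv q.1 + 1) → 2 ≤ p.2.2.val ∨ 2 ≤ q.2.2.val) :
    wilsonDiracG ρ chiralGamma V m 1 p q = 0 := by
  refine wdc_eq_zero ρ V m (fun h => ht (by rw [h])) (fun h => hf0 ?_) (fun h => hb0 ?_)
    (fun k hk h => ht ?_) (fun k hk h => ht ?_)
  · rw [h, tv_shift_zero]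
  · rw [h, tv_shift_zero]
  · rw [h, tv_shift_ne _ hk]
  · rw [h, tv_shift_ne _ hk]

/-- Sites with the same time are not time neighbours. -/
theorem tv_ne_tv_shift_zero {x y : TorusSite 4 L} (h : tv x = tv y) : y ≠ Site.shift x 0 := by
  intro e
  have := congrArg tv e
  rw [tv_shift_zero] at this
  have hx := tv_lt x
  have h1 : 1 < L := Fact.out
  split_ifs at this <;> omega

/-- **Same-slice entries**: between indices of the same time and compatible chirality the entry is
spin-diagonal and given by the spatial plane operator. -/
theorem wdc_sameSlice (V : GaugeConfig 4 L G) (m : ℝ) {p q : TorusSite 4 L × Fin N × Fin 4}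
    (ht : tv p.1 = tv q.1) (hc : p.2.2.val < 2 ↔ q.2.2.val < 2) :
    wilsonDiracG ρ chiralGamma V m 1 p q =
      if p.2.2 = q.2.2 then planeOp ρ V m p.1 p.2.1 q.1 q.2.1 else 0 := by
  obtain ⟨x, a, α⟩ := p
  obtain ⟨y, b, β⟩ := q
  simp only at ht hc ⊢
  have hf : y ≠ Site.shift x 0 := tv_ne_tv_shift_zero ht
  have hb : x ≠ Site.shift y 0 := tv_ne_tv_shift_zero ht.symm
  simp only [wilsonDiracG, planeOp, Matrix.of_apply, Complex.ofReal_one, one_smul, mul_one]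
  by_cases hs : α = β
  · subst hs
    rw [if_pos rfl]
    congr 1
    · by_cases hxy : x = y ∧ a = b
      · rw [if_pos hxy, if_pos (by rw [hxy.1, hxy.2])]
      · rw [if_neg hxy, if_neg]
        simpa only [Prod.mk.injEq, and_true] using hxy
    · congr 1
      refine Finset.sum_congr rfl fun μ _ => ?_
      by_cases hμ : μ = 0
      · subst hμ
        rw [if_neg hf, if_neg hb, if_pos rfl, add_zero]
      · rw [if_neg hμ, projMinus_spatial_apply μ α α hμ Iff.rfl, projPlus_spatial_apply μ α α hμ Iff.rfl,
          if_pos rfl, one_mul, one_mul]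
  · rw [if_neg hs, if_neg (fun h => hs (by simp only [Prod.mk.injEq] at h; exact h.2.2)), zero_sub,
      neg_eq_zero]
    refine mul_eq_zero.2 (Or.inr (Finset.sum_eq_zero fun μ _ => ?_))
    by_cases hμ : μ = 0
    · subst hμ
      rw [if_neg hf, if_neg hb, add_zero]
    · rw [projMinus_spatial_apply μ α β hμ hc, projPlus_spatial_apply μ α β hμ hc, if_neg hs, zero_mul,
        zero_mul, ite_self, ite_self, add_zero]

end Entries

/-! ## The upper index class, the plane flip and the site reflection on indices -/

section Classes

variable {L N : ℕ} [NeZero L]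

/-- The plane indices: those on the reflection planes `t = 0`, `t = L/2`. -/
def planeIdx : Finset (TorusSite 4 L × Fin N × Fin 4) :=
  Finset.univ.filter fun p => tv p.1 = 0 ∨ tv p.1 = L / 2

/-- The UPPER indices: interior `0 < t < L/2` (all spins), plane `t = 0` with the lower
(`γ₀ = -1`) spinor components, plane `t = L/2` with the upper ones. -/
def upIdx : Finset (TorusSite 4 L × Fin N × Fin 4) :=
  Finset.univ.filter fun p =>
    (0 < tv p.1 ∧ tv p.1 < L / 2) ∨ (tv p.1 = 0 ∧ 2 ≤ p.2.2.val) ∨ (tv p.1 = L / 2 ∧ p.2.2.val < 2)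

/-- Membership in `planeIdx`. -/
theorem mem_planeIdx {p : TorusSite 4 L × Fin N × Fin 4} : p ∈ planeIdx ↔ tv p.1 = 0 ∨ tv p.1 = L / 2 := by
  simp [planeIdx]

/-- Membership in `upIdx`. -/
theorem mem_upIdx {p : TorusSite 4 L × Fin N × Fin 4} : p ∈ upIdx ↔
    (0 < tv p.1 ∧ tv p.1 < L / 2) ∨ (tv p.1 = 0 ∧ 2 ≤ p.2.2.val) ∨ (tv p.1 = L / 2 ∧ p.2.2.val < 2) := by
  simp [upIdx]

/-- The chirality flip of the spin index. -/
def flipSpin (p : TorusSite 4 L × Fin N × Fin 4) : TorusSite 4 L × Fin N × Fin 4 := (p.1, p.2.1, sflip p.2.2)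

/-- The plane flip `π`: chirality flip on plane indices, identity elsewhere. -/
def piMap (p : TorusSite 4 L × Fin N × Fin 4) : TorusSite 4 L × Fin N × Fin 4 :=
  if p ∈ planeIdx then flipSpin p else p

/-- The site reflection `σ` on indices (sites by `t ↦ -t`, colour and spin fixed). -/
def sigmaMap (p : TorusSite 4 L × Fin N × Fin 4) : TorusSite 4 L × Fin N × Fin 4 := (siteTimeNeg p.1, p.2.1, p.2.2)

/-- Time of `σ p`. -/
theorem tv_sigmaMap (p : TorusSite 4 L × Fin N × Fin 4) :
    tv (sigmaMap p).1 = if tv p.1 = 0 then 0 else L - tv p.1 :=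
  tv_siteTimeNeg p.1

/-- `σ` fixes plane indices. -/
theorem sigmaMap_of_mem_planeIdx (hL : Even L) {p : TorusSite 4 L × Fin N × Fin 4} (h : p ∈ planeIdx) :
    sigmaMap p = p := by
  unfold sigmaMap
  rw [siteTimeNeg_of_plane hL (mem_planeIdx.1 h)]

/-- `π` on plane indices. -/
theorem piMap_of_mem {p : TorusSite 4 L × Fin N × Fin 4} (h : p ∈ planeIdx) : piMap p = flipSpin p :=
  if_pos h

/-- `π` off the planes. -/
theorem piMap_of_not_mem {p : TorusSite 4 L × Fin N × Fin 4} (h : p ∉ planeIdx) : piMap p = p :=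
  if_neg h

end Classes

/-! ## The cross blocks -/

section Cross

variable {L N : ℕ} [NeZero L] [Fact (1 < L)] {G : Type*} [Group G]
  (ρ : G →* Matrix (Fin N) (Fin N) ℂ)

/-- Same-plane entries are unchanged under the chirality flip of both indices. -/
theorem wdc_flipSpin_flipSpin (hL : Even L) (V : GaugeConfig 4 L G) (m : ℝ)
    {p q : TorusSite 4 L × Fin N × Fin 4} (hp : p ∈ upIdx) (hq : q ∈ upIdx) (hPp : p ∈ planeIdx)
    (hPq : q ∈ planeIdx) (h4 : 4 ≤ L) :
    wilsonDiracG ρ chiralGamma V m 1 (flipSpin p) (flipSpin q) = wilsonDiracG ρ chiralGamma V m 1 p q := by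
  have hL' := Nat.even_iff.1 hL
  rw [mem_upIdx] at hp hq
  rw [mem_planeIdx] at hPp hPq
  by_cases ht : tv p.1 = tv q.1
  · have hc : p.2.2.val < 2 ↔ q.2.2.val < 2 := by omega
    have hc' : (sflip p.2.2).val < 2 ↔ (sflip q.2.2).val < 2 := by
      rw [sflip_val, sflip_val]; split_ifs <;> omega
    rw [wdc_sameSlice ρ V m (p := flipSpin p) (q := flipSpin q) ht hc', wdc_sameSlice ρ V m ht hc]
    simp only [flipSpin, sflip_injective.eq_iff]
  · rw [wdc_eq_zero_of_tv ρ V m (p := flipSpin p) (q := flipSpin q) ht, wdc_eq_zero_of_tv ρ V m ht]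
    all_goals first
      | (simp only [flipSpin]; intro h; exfalso; split_ifs at h <;> omega)
      | (intro h; exfalso; split_ifs at h <;> omega)

/-- **First cross block**: for upper `p, q`, `D'(p, σ q) = [p, q plane] D'(p, q)`. -/
theorem crossBlock₁_entry (hL : Even L) (h4 : 4 ≤ L) (V : GaugeConfig 4 L G) (m : ℝ)
    {p q : TorusSite 4 L × Fin N × Fin 4} (hp : p ∈ upIdx) (hq : q ∈ upIdx) :
    wilsonDiracG ρ chiralGamma V m 1 p (sigmaMap q) =
      if p ∈ planeIdx ∧ q ∈ planeIdx then wilsonDiracG ρ chiralGamma V m 1 p q else 0 := by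
  have hL' := Nat.even_iff.1 hL
  have hpl := tv_lt p.1
  have hql := tv_lt q.1
  by_cases hPq : q ∈ planeIdx
  · rw [sigmaMap_of_mem_planeIdx hL hPq]
    by_cases hPp : p ∈ planeIdx
    · rw [if_pos ⟨hPp, hPq⟩]
    · rw [if_neg (fun h => hPp h.1)]
      rw [mem_upIdx] at hp hq; rw [mem_planeIdx] at hPp hPq
      refine wdc_eq_zero_of_tv ρ V m ?_ ?_ ?_
      · omega
      · intro h; split_ifs at h <;> omega
      · intro h; split_ifs at h <;> omega
  · rw [if_neg (fun h => hPq h.2)]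
    rw [mem_upIdx] at hp hq; rw [mem_planeIdx] at hPq
    refine wdc_eq_zero_of_tv ρ V m ?_ ?_ ?_
    · rw [tv_sigmaMap]; split_ifs <;> omega
    · rw [tv_sigmaMap]; intro h
      simp only [sigmaMap]
      split_ifs at h <;> omega
    · rw [tv_sigmaMap]; intro h
      simp only [sigmaMap]
      split_ifs at h <;> omega

end Cross

/-- **Second cross block**: for upper `p, q`, `D'(σ π p, π q) = [p, q plane] D'(p, q)`. -/
theorem crossBlock₂_entry {L N : ℕ} [NeZero L] [Fact (1 < L)] {G : Type*} [Group G]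
    (ρ : G →* Matrix (Fin N) (Fin N) ℂ) (hL : Even L) (h4 : 4 ≤ L) (V : GaugeConfig 4 L G) (m : ℝ)
    {p q : TorusSite 4 L × Fin N × Fin 4} (hp : p ∈ upIdx) (hq : q ∈ upIdx) :
    wilsonDiracG ρ chiralGamma V m 1 (sigmaMap (piMap p)) (piMap q) =
      if p ∈ planeIdx ∧ q ∈ planeIdx then wilsonDiracG ρ chiralGamma V m 1 p q else 0 := by
  have hL' := Nat.even_iff.1 hL
  have hpl := tv_lt p.1
  have hql := tv_lt q.1
  by_cases hPp : p ∈ planeIdx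
  · have hPp' : flipSpin p ∈ planeIdx := by rw [mem_planeIdx] at hPp ⊢; exact hPp
    rw [piMap_of_mem hPp, sigmaMap_of_mem_planeIdx hL hPp']
    by_cases hPq : q ∈ planeIdx
    · rw [piMap_of_mem hPq, if_pos ⟨hPp, hPq⟩]
      exact wdc_flipSpin_flipSpin ρ hL V m hp hq hPp hPq h4
    · rw [piMap_of_not_mem hPq, if_neg (fun h => hPq h.2)]
      rw [mem_upIdx] at hp hq; rw [mem_planeIdx] at hPp hPq
      refine wdc_eq_zero_of_tv ρ V m ?_ ?_ ?_
      · simp only [flipSpin]; omega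
      · simp only [flipSpin, sflip_val]; intro h; split_ifs at h ⊢ <;> omega
      · simp only [flipSpin, sflip_val]; intro h; split_ifs at h ⊢ <;> omega
  · rw [piMap_of_not_mem hPp, if_neg (fun h => hPp h.1)]
    by_cases hPq : q ∈ planeIdx
    · rw [piMap_of_mem hPq]
      rw [mem_upIdx] at hp hq; rw [mem_planeIdx] at hPp hPq
      refine wdc_eq_zero_of_tv ρ V m ?_ ?_ ?_
      · rw [tv_sigmaMap]; simp only [flipSpin]; split_ifs <;> omega
      · rw [tv_sigmaMap]; simp only [flipSpin, sigmaMap, sflip_val]; intro h; split_ifs at h ⊢ <;> omega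
      · rw [tv_sigmaMap]; simp only [flipSpin, sigmaMap, sflip_val]; intro h; split_ifs at h ⊢ <;> omega
    · rw [piMap_of_not_mem hPq]
      rw [mem_upIdx] at hp hq; rw [mem_planeIdx] at hPp hPq
      refine wdc_eq_zero_of_tv ρ V m ?_ ?_ ?_
      · rw [tv_sigmaMap]; split_ifs <;> omega
      · rw [tv_sigmaMap]; simp only [sigmaMap]; intro h; split_ifs at h <;> omega
      · rw [tv_sigmaMap]; simp only [sigmaMap]; intro h; split_ifs at h <;> omega


end Summit.QuantumFields.QCD.Theorems.UnquenchedChessboardBoundLine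

end
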